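import Literature.IUT.LogThetaLattice.PacketLogVolumesHaarModel
import HarnessLib

/-!
# [IUTchIII] Proposition 3.9 (iii), degree clause, at the GENUINE adelic Haar model: the global
# log-volume of a family of fractional ideals `𝔍 = {J_v}` is `deg_F(𝔍)/[F:ℚ]` (abc-iut cell, layer L6)

S. Mochizuki, *Inter-universal Teichmüller theory III*, kurims manuscript (May 2020), §3, Proposition 3.9
(iii), p. 117 [claim: Mochizuki2012, status: disputed]: "if we consider finite collections of "pieces" of
objects "`𝔍 = {𝔍_v}_{v∈𝕍}`" of the category `(†𝓕⊛_𝔪𝔬𝔡)_α` [cf. Example 3.6, (ii); Proposition 3.7, (ii)] …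
then the global log-volume `μ^log_{A,𝕍_ℚ}(𝔍)` is equal to the degree of the arithmetic line bundle
determined by `𝔍` [cf. the discussion of Example 3.6, (ii); the natural isomorphism `(†𝓕⊛_mod)_α ⥲
(†𝓕⊛_𝔪𝔬𝔡)_α` of Proposition 3.7, (ii)], relative to a suitable normalization." Example 3.6 (ii), p. 106:
"collections `{𝔍_v}_{v ∈ 𝕍}` of "fractional ideals", i.e., finitely generated nonzero
`𝒪_{K_v}`-submodules of `K_v` [when `v ∈ 𝕍^non`], positive real multiples of `𝒪_{K_v}` [when `v ∈ 𝕍^arc`],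
such that `𝔍_v = 𝒪_{K_v}` for all but finitely many `v`" (paraphrase of the locator; the verbatim sentence is
in abc-iut-L6-t6's `GlobalFrobenioidModelsData.lean`).

This is the companion of `PacketLogVolumesHaarModel.lean` (abc-iut-L6-d3; the model `haarPacketLogVolume` on
genuine regions `∏_{v|v_ℚ} T_v ⊆ ⊕_{v|v_ℚ} F_v` with Haar / radial volumes and Remark 3.1.1 (ii) weights, and the
INVARIANCE clause `prop39iii_invariance_haarModel`). Here the DEGREE clause, abc-iut-L6-t4's predicate
`Prop39iii_degree μlog regionOf deg` (`PacketLogVolumes.lean`), is PROVED at that model for the objects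
`𝔍 = {J_v}` of the quoted sentence in the case `K = F_mod = F`:
* `IdealFamily F` — at each finite `v` an exponent `n_v ∈ ℤ`, almost all `0` (the fractional ideal
  `J_v = 𝔭_v^{-n_v}𝒪_v = {x ∈ F_v : ‖x‖_v ≤ q_v^{n_v}}`), at each archimedean `w` a real `t_w` (the "positive real
  multiple" `J_w = e^{t_w}·𝒪_ℂ` of the unit disc);
* `haarIdealRegion 𝔍` — the GENUINE global region `(J_v)_v` (these are admissible: `μ_v(𝔭_v^{-n}𝒪_v) = q_v^{n}`
  by `mod_{F_v}(ϖ_v) = q_v^{-1}` — the tree's `distribHaarChar_eq_norm` / `units_smul_unitBall`; `μ(e^t·𝒪_ℂ) = e^t`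
  by `radialVolume_smul`);
* `IdealFamily.toADivisor 𝔍` — the arithmetic divisor `Σ_v n_v·v + Σ_w [F_w:ℝ]·t_w·w` of the line bundle
  determined by `𝔍`, `deg 𝔍 := deg_F` of it ([IUTchIV] Def. 1.9 (i), campaign-S `degF`: weights `log q_v`
  resp. `1`);
* **`globalLogVolume_haarIdealRegion : μ^log_{𝕍_ℚ}(𝔍) = deg_F(𝔍)/[F:ℚ]`** and
  **`prop39iii_degree_haarModel : Prop39iii_degree (haarPacketLogVolume F) (haarIdealRegion F) deg`** with the
  "suitable normalization" made explicit: the constant is `c = 1/[F:ℚ]` (= the normalized weight of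
  Remark 3.1.1 (ii)); equivalently `μ^log_{𝕍_ℚ}(𝔍)` IS the normalised degree of [IUTchIV] Def. 1.9 (i).
Also: the unit family `𝒪 = {𝒪_v}` has global log-volume `0` (Prop. 3.9 (i) "the log-volume of each of the
"local holomorphic" integral structures … is equal to zero", summed), and multiplication by `f ∈ F^×` carries
`haarIdealRegion 𝔍` to a region of the same global log-volume (`prop39iii_invariance_haarModel`).

HONEST SCOPE as in the companion file (`K = F_mod = F`, `|A| = 1`, archimedean summand `ℂ` with the radial
volume). Nothing here constructs `(†𝓕⊛_𝔪𝔬𝔡)_α` as a Frobenioid (abc-iut-L6-t6 `GlobalFrobenioidModels*`),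
asserts anything about [IUTchIII] Cor. 3.12, or takes a side; typed ≠ endorsed. The mathematics is classical.
-/

noncomputable section

namespace Literature.IUT.LogThetaLattice

open Literature.IUT.LogVolume NumberField IsDedekindDomain MeasureTheory Metric Set
open Literature.NumberTheory.GaloisRepresentations.Ultrametric
open scoped ENNReal NNReal Pointwise

variable (F : Type) [Field F] [NumberField F]

/-! ### Objects `𝔍 = {J_v}`: fractional ideals at finite places, dilated unit discs at archimedean ones -/

/-- **[IUTchIII] Ex. 3.6 (ii) / Prop. 3.9 (iii) objects `𝔍 = {J_v}_{v ∈ 𝕍}`** in the case `K = F_mod = F`: a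
fractional ideal `J_v = 𝔭_v^{-n_v}𝒪_v` at each finite place (`n_v ∈ ℤ`, `n_v = 0` for almost all `v`) and a
positive real multiple `J_w = e^{t_w}·𝒪_ℂ` of the unit disc at each archimedean place.
[claim: Mochizuki2012, status: disputed] -/
structure IdealFamily : Type where
  /-- `t_w`: `J_w = e^{t_w}·𝒪_ℂ` at the archimedean place `w` -/
  arch : InfinitePlace F → ℝ
  /-- `n_v`: `J_v = 𝔭_v^{-n_v}𝒪_v` at the finite place `v`, almost all `0` -/
  fin : HeightOneSpectrum (𝓞 F) →₀ ℤ

namespace IdealFamily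

variable {F}

/-- The unit family `𝒪 = {𝒪_v}_v` (all `n_v = 0`, `t_w = 0`). [claim: Mochizuki2012, status: disputed] -/
def unit : IdealFamily F := ⟨fun _ => 0, 0⟩

/-- The arithmetic divisor of the line bundle determined by `𝔍`: coefficient `n_v` at a finite `v`,
`[F_w:ℝ]·t_w` at an archimedean `w` (so that its `deg_F`, with the weights `log q_v` resp. `1` of [IUTchIV]
Def. 1.9 (i), is `Σ_v n_v·log q_v + Σ_w [F_w:ℝ]·t_w`). [claim: Mochizuki2012, status: disputed] -/
def toADivisor (J : IdealFamily F) : ADivisor F :=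
  (Finsupp.equivFunOnFinite.symm fun w => (w.mult : ℝ) * J.arch w).sumElim
    (J.fin.mapRange (fun n : ℤ => (n : ℝ)) (by simp))

/-- Archimedean coefficient `[F_w:ℝ]·t_w`. [claim: Mochizuki2012, status: disputed] -/
@[simp] theorem toADivisor_inl (J : IdealFamily F) (w : InfinitePlace F) :
    J.toADivisor (Sum.inl w) = (w.mult : ℝ) * J.arch w := rfl

/-- Finite coefficient `n_v`. [claim: Mochizuki2012, status: disputed] -/
@[simp] theorem toADivisor_inr (J : IdealFamily F) (v : HeightOneSpectrum (𝓞 F)) :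
    J.toADivisor (Sum.inr v) = (J.fin v : ℝ) := rfl

/-- The degree of the arithmetic line bundle determined by `𝔍`: `deg_F(𝔍) := deg_F(toADivisor 𝔍) =
Σ_v n_v·log q_v + Σ_w [F_w:ℝ]·t_w`. [claim: Mochizuki2012, status: disputed] -/
def deg (J : IdealFamily F) : ℝ := degF F J.toADivisor

/-- `deg_F(𝒪) = 0`. [claim: Mochizuki2012, status: disputed] -/
theorem deg_unit : (unit : IdealFamily F).deg = 0 := by
  have h : (unit : IdealFamily F).toADivisor = 0 := by
    ext v
    rcases v with w | v <;> simp [unit]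
  rw [deg, h, map_zero]

end IdealFamily

/-! ### The genuine regions `J_w = e^{t}·𝒪_ℂ` and `J_v = 𝔭_v^{-n}𝒪_v`, and their volumes -/

/-- `e^{t}·𝒪_ℂ = closedBall 0 e^{t} ⊆ ℂ` has radial volume `e^{t}`. [claim: Mochizuki2012, status: disputed] -/
theorem radialVolume_closedBall_exp (t : ℝ) :
    radialVolume (closedBall (0 : ℂ) (Real.exp t)) = ENNReal.ofReal (Real.exp t) := by
  have h : closedBall (0 : ℂ) (Real.exp t) = ((Real.exp t : ℝ) : ℂ) • closedBall (0 : ℂ) 1 := by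
    rw [_root_.smul_closedBall _ _ zero_le_one, smul_zero, mul_one, Complex.norm_real, Real.norm_eq_abs,
      abs_of_pos (Real.exp_pos t)]
  rw [h, radialVolume_smul, radialVolume_closedBall_one, mul_one, Complex.norm_real, Real.norm_eq_abs,
    abs_of_pos (Real.exp_pos t)]

/-- The archimedean component `J_w = e^{t}·𝒪_ℂ` as an admissible region of the archimedean summand
(`0 < e^t < ∞`). [claim: Mochizuki2012, status: disputed] -/
def archIdealRegion (w : InfinitePlace F) (t : ℝ) : (archDatum F w).Adm :=
  ⟨(closedBall (0 : ℂ) (Real.exp t) : Set ℂ), by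
    show 0 < radialVolume (closedBall (0 : ℂ) (Real.exp t)) ∧ radialVolume (closedBall (0 : ℂ) (Real.exp t)) < ∞
    rw [radialVolume_closedBall_exp]
    exact ⟨ENNReal.ofReal_pos.mpr (Real.exp_pos t), ENNReal.ofReal_lt_top⟩⟩

omit [NumberField F] in
/-- Its radial log-volume is `t`. [claim: Mochizuki2012, status: disputed] -/
theorem archIdealRegion_logVol (w : InfinitePlace F) (t : ℝ) :
    (archDatum F w).logVol (archIdealRegion F w t).1 = t := by
  show Real.log (radialVolume (closedBall (0 : ℂ) (Real.exp t))).toReal = t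
  rw [radialVolume_closedBall_exp, ENNReal.toReal_ofReal (Real.exp_pos t).le, Real.log_exp]

/-- **`μ_v(𝔭_v^{-n}𝒪_v) = q_v^{n}`**: the fractional ideal `{‖x‖_v ≤ q_v^n} = ϖ_v^{-n}·𝒪_v` has Haar volume
`mod_{F_v}(ϖ_v^{-n}) = q_v^{n}` ([AbsTopIII] Prop. 5.7 (i)(a) "`μ^log_k(𝔪_k^n) = −f·n·log(p)`"; tree:
`exists_valuation_eq_exp_neg_one`, `isUniformizer_of_valuation_eq`, `units_smul_unitBall`,
`localVolume_units_smul`, `CompletionModel.distribHaarChar_eq_norm`). [claim: Mochizuki2012, status: disputed] -/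
theorem nonarchDatum_vol_closedBall_zpow (v : HeightOneSpectrum (𝓞 F)) (n : ℤ) :
    (nonarchDatum F v).vol
        (closedBall (0 : v.adicCompletion F) ((Ideal.absNorm v.asIdeal : ℝ) ^ n) : Set (v.adicCompletion F)) =
      ENNReal.ofReal ((Ideal.absNorm v.asIdeal : ℝ) ^ n) := by
  letI := AdicCompletion.nontriviallyNormedField F v
  letI : ProperSpace (v.adicCompletion F) := Literature.NumberTheory.Automorphic.properSpace_adicCompletion F v
  letI : MeasurableSpace (v.adicCompletion F) := CompletionModel.measurableSpace F v
  haveI : BorelSpace (v.adicCompletion F) := ⟨rfl⟩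
  obtain ⟨ϖ, hϖ⟩ := Literature.NumberTheory.Automorphic.exists_valuation_eq_exp_neg_one F v
  have hu := AdicCompletion.isUniformizer_of_valuation_eq F v ϖ (by rw [hϖ]; rfl)
  have hN : (0 : ℝ) < (Ideal.absNorm v.asIdeal : ℝ) := by
    have := NumberField.HeightOneSpectrum.one_lt_absNorm v
    positivity
  have hnorm : ‖((ϖ ^ (-n) : (v.adicCompletion F)ˣ) : v.adicCompletion F)‖ = (Ideal.absNorm v.asIdeal : ℝ) ^ n := by
    rw [Units.val_zpow_eq_zpow_val, norm_zpow, hu.2, inv_zpow', neg_neg]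
  have hball : closedBall (0 : v.adicCompletion F) ((Ideal.absNorm v.asIdeal : ℝ) ^ n) =
      (ϖ ^ (-n)) • closedBall (0 : v.adicCompletion F) 1 := by
    rw [units_smul_unitBall, hnorm]
  have hmod := CompletionModel.distribHaarChar_eq_norm F v (ϖ ^ (-n))
  rw [hnorm] at hmod
  show localVolume (v.adicCompletion F) _ = _
  rw [hball, localVolume_units_smul, localVolume_closedBall_one, mul_one, ← hmod, ENNReal.ofReal_coe_nnreal]

/-- The finite component `J_v = 𝔭_v^{-n}𝒪_v = {‖x‖_v ≤ q_v^{n}}` as an admissible region of the summand `F_v`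
(`0 < q_v^n < ∞`). [claim: Mochizuki2012, status: disputed] -/
def nonarchIdealRegion (v : HeightOneSpectrum (𝓞 F)) (n : ℤ) : (nonarchDatum F v).Adm :=
  ⟨(closedBall (0 : v.adicCompletion F) ((Ideal.absNorm v.asIdeal : ℝ) ^ n) : Set (v.adicCompletion F)), by
    have hN : (0 : ℝ) < (Ideal.absNorm v.asIdeal : ℝ) ^ n := by
      have := NumberField.HeightOneSpectrum.one_lt_absNorm v
      positivity
    refine ⟨?_, ?_⟩
    · rw [nonarchDatum_vol_closedBall_zpow F v n]; exact ENNReal.ofReal_pos.mpr hN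
    · rw [nonarchDatum_vol_closedBall_zpow F v n]; exact ENNReal.ofReal_lt_top⟩

/-- **`μ^log_v(𝔭_v^{-n}𝒪_v) = n·log q_v`**. [claim: Mochizuki2012, status: disputed] -/
theorem nonarchIdealRegion_logVol (v : HeightOneSpectrum (𝓞 F)) (n : ℤ) :
    (nonarchDatum F v).logVol (nonarchIdealRegion F v n).1 = n * logNorm F v := by
  have hN : (0 : ℝ) < (Ideal.absNorm v.asIdeal : ℝ) := by
    have := NumberField.HeightOneSpectrum.one_lt_absNorm v
    positivity
  show Real.log ((nonarchDatum F v).vol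
    (closedBall (0 : v.adicCompletion F) ((Ideal.absNorm v.asIdeal : ℝ) ^ n) : Set (v.adicCompletion F))).toReal = _
  rw [nonarchDatum_vol_closedBall_zpow F v n, ENNReal.toReal_ofReal (zpow_pos hN n).le, Real.log_zpow, logNorm]

/-- The component of `𝔍` at a place `v ∈ 𝕍(F)`, as an admissible region of the summand at `v`.
[claim: Mochizuki2012, status: disputed] -/
def idealRegionAt (J : IdealFamily F) : ∀ v : Place F, (placeDatum F v).Adm
  | Sum.inl w => archIdealRegion F w (J.arch w)
  | Sum.inr v => nonarchIdealRegion F v (J.fin v)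

/-- **Per place**: `c_v · μ^log_v(J_v) = (1/[F:ℚ]) · (𝔞_v · w_v)` where `𝔞 = toADivisor 𝔍` and `w_v` is the degree
weight `log q_v` resp. `1` — at finite `v`: `(1/[F:ℚ])·n·log q_v`; at archimedean `w`: `([F_w:ℝ]/[F:ℚ])·t`.
[claim: Mochizuki2012, status: disputed] -/
theorem haarWeight_mul_logVol_idealRegionAt (J : IdealFamily F) (v : Place F) :
    haarWeight F v * (placeDatum F v).logVol (idealRegionAt F J v).1 =
      (1 / Module.finrank ℚ F) * (J.toADivisor v * degWeight F v) := by
  rcases v with w | v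
  · show haarWeight F (Sum.inl w) * (archDatum F w).logVol (archIdealRegion F w (J.arch w)).1 = _
    rw [archIdealRegion_logVol, haarWeight_inl, IdealFamily.toADivisor_inl, degWeight_inl]
    ring
  · show haarWeight F (Sum.inr v) * (nonarchDatum F v).logVol (nonarchIdealRegion F v (J.fin v)).1 = _
    rw [nonarchIdealRegion_logVol, haarWeight_inr, IdealFamily.toADivisor_inr, degWeight_inr]

/-- The terms `𝔞_v·w_v` of `deg_F(𝔞)` are finitely supported. [claim: Mochizuki2012, status: disputed] -/
theorem finite_support_toADivisor_mul_degWeight (J : IdealFamily F) :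
    (Function.support fun v : Place F => J.toADivisor v * degWeight F v).Finite :=
  Set.Finite.subset J.toADivisor.hasFiniteSupport fun _ hv =>
    Function.mem_support.mpr (left_ne_zero_of_mul (Function.mem_support.mp hv))

/-! ### The global region of `𝔍` and its global log-volume -/

/-- **[IUTchIII] Prop. 3.9 (iii)** (p. 117) the region "`𝔍`" of the global packet `𝓘^ℚ(^A𝓕_{𝕍_ℚ})` attached to
`𝔍 = {J_v}`: at `v_ℚ` the direct-product region `∏_{v | v_ℚ} J_v ⊆ ⊕_{v|v_ℚ} F_v` — a GLOBAL region, i.e. of zero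
packet log-volume at all but finitely many `v_ℚ` (`n_v = 0` ⇒ `μ^log_v(J_v) = 0`).
[claim: Mochizuki2012, status: disputed] -/
def haarIdealRegion (J : IdealFamily F) : GlobalRegion (haarPacketLogVolume F) :=
  ⟨fun q v => idealRegionAt F J v.1, by
    have h := finite_support_packet_sum F _
      ((finite_support_toADivisor_mul_degWeight F J).subset fun v hv => by
        have hv' : haarWeight F v * (placeDatum F v).logVol (idealRegionAt F J v).1 ≠ 0 :=
          Function.mem_support.mp hv
        rw [haarWeight_mul_logVol_idealRegionAt] at hv'
        exact Function.mem_support.mpr (right_ne_zero_of_mul hv'))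
    exact h⟩

/-- Components of the region of `𝔍`. [claim: Mochizuki2012, status: disputed] -/
@[simp] theorem haarIdealRegion_apply (J : IdealFamily F) (q : RatPlace) (v : Packet F q) :
    (haarIdealRegion F J).1 q v = idealRegionAt F J v.1 := rfl

/-- The packet log-volume of `𝔍` at `v_ℚ` is `(1/[F:ℚ])` times the `v_ℚ`-part `Σ_{v|v_ℚ} 𝔞_v·w_v` of `deg_F(𝔞)`
(abc-iut-L6-d3's `packetDivisorLogVolume` of gen 2). [claim: Mochizuki2012, status: disputed] -/
theorem haarPacketLogVolume_haarIdealRegion (J : IdealFamily F) (q : RatPlace) :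
    haarPacketLogVolume F q ((haarIdealRegion F J).1 q) =
      (1 / Module.finrank ℚ F) * packetDivisorLogVolume F q ((packetRegionOf F J.toADivisor).1 q) := by
  simp only [haarPacketLogVolume, haarIdealRegion_apply, haarWeight_mul_logVol_idealRegionAt,
    packetDivisorLogVolume, packetRegionOf_apply, ← Finset.mul_sum]

/-- **`μ^log_{𝕍_ℚ}(𝔍) = deg_F(𝔍)/[F:ℚ]`**: "by adding the log-volumes … at the various `v_ℚ ∈ 𝕍_ℚ`" of the genuine
regions `∏_{v|v_ℚ} J_v` one obtains the NORMALISED arithmetic degree of the line bundle determined by `𝔍`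
(gen-2 regrouping `globalLogVolume_packetRegionOf`: `Σ_{v_ℚ} Σ_{v|v_ℚ} 𝔞_v·w_v = deg_F(𝔞)`).
[claim: Mochizuki2012, status: disputed] -/
theorem globalLogVolume_haarIdealRegion (J : IdealFamily F) :
    globalLogVolume (haarPacketLogVolume F) (haarIdealRegion F J) = J.deg / Module.finrank ℚ F := by
  have h := globalLogVolume_packetRegionOf F J.toADivisor
  rw [globalLogVolume] at h ⊢
  simp only [haarPacketLogVolume_haarIdealRegion]
  rw [← mul_finsum, h, IdealFamily.deg, one_div, inv_mul_eq_div]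

/-- **IUTchIII:Prop3.9(iii)** (kurims p. 117) DEGREE CLAUSE AT THE GENUINE HAAR MODEL: "the global log-volume
`μ^log_{A,𝕍_ℚ}(𝔍)` is equal to the degree of the arithmetic line bundle determined by `𝔍` …, relative to a suitable
normalization" — abc-iut-L6-t4's `Prop39iii_degree (haarPacketLogVolume F) (haarIdealRegion F) deg` HOLDS, the
normalisation constant being `c = 1/[F:ℚ]` (the normalized weight of Remark 3.1.1 (ii)).
[claim: Mochizuki2012, status: disputed] -/
theorem prop39iii_degree_haarModel :
    Prop39iii_degree (haarPacketLogVolume F) (haarIdealRegion F) IdealFamily.deg :=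
  ⟨1 / Module.finrank ℚ F, div_pos one_pos (FinDivisor.finrank_pos (F := F)), fun J => by
    rw [globalLogVolume_haarIdealRegion, one_div, ← div_eq_inv_mul]⟩

/-- The same with the tree's NORMALISED degree of an arithmetic divisor (`ndeg = deg_F/[F:ℚ]`, [IUTchIV] Def. 1.9
(i) "`deg(𝔞) := [F:ℚ]^{-1}·deg_F(𝔞)`"): `μ^log_{𝕍_ℚ}(𝔍) = deg(𝔞_𝔍)` on the nose.
[claim: Mochizuki2012, status: disputed] -/
theorem globalLogVolume_haarIdealRegion_eq_ndeg (J : IdealFamily F) :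
    globalLogVolume (haarPacketLogVolume F) (haarIdealRegion F J) = ndeg F J.toADivisor := by
  rw [globalLogVolume_haarIdealRegion, ndeg_apply, IdealFamily.deg]

/-- **[IUTchIII] Prop. 3.9 (i)/(iii)**: the unit family `𝒪 = {𝒪_v}` — "the "local holomorphic" integral
structures … the log-volume of each … is equal to zero" — has global log-volume `0` at the genuine model.
[claim: Mochizuki2012, status: disputed] -/
theorem globalLogVolume_haarIdealRegion_unit :
    globalLogVolume (haarPacketLogVolume F) (haarIdealRegion F IdealFamily.unit) = 0 := by
  rw [globalLogVolume_haarIdealRegion, IdealFamily.deg_unit, zero_div]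

/-- Consequently `f·𝔍` (each `J_v` multiplied by `f ∈ F^×`) has global log-volume `deg_F(𝔍)/[F:ℚ]` as well —
the invariance clause `prop39iii_invariance_haarModel` applied to the region of `𝔍` (the principal line
bundle `(f)` has degree `0`). [claim: Mochizuki2012, status: disputed] -/
theorem globalLogVolume_haarPrincipalAction_haarIdealRegion (f : Fˣ) (J : IdealFamily F) :
    globalLogVolume (haarPacketLogVolume F) (haarPrincipalAction F f (haarIdealRegion F J)) =
      J.deg / Module.finrank ℚ F := by
  rw [globalLogVolume_haarPrincipalAction, globalLogVolume_haarIdealRegion]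

/-- NON-VACUITY of the invariance clause at the genuine model: the action MOVES regions — at a finite place `v`
with `ord_v(f) ≠ 0` the fractional ideal `f·𝒪_v` has log-volume `log‖f‖_v ≠ 0 = μ^log_v(𝒪_v)`, so
`f·𝒪 ≠ 𝒪` as global regions. [claim: Mochizuki2012, status: disputed] -/
theorem haarPrincipalAction_unit_ne {f : Fˣ} {v : HeightOneSpectrum (𝓞 F)} (hv : ord F v (f : F) ≠ 0) :
    haarPrincipalAction F f (haarIdealRegion F IdealFamily.unit) ≠ haarIdealRegion F IdealFamily.unit := by
  intro h
  have h1 := congrArg (fun S : GlobalRegion (haarPacketLogVolume F) =>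
    (placeDatum F (Sum.inr v)).logVol (S.1 (ratPlaceBelow F (Sum.inr v)) (Packet.ofPlace F (Sum.inr v))).1) h
  simp only [haarPrincipalAction_apply, haarIdealRegion_apply, Packet.ofPlace] at h1
  rw [PlaceHaarDatum.logVol_actAdm, add_eq_left, placeDatum_inr, nonarchDatum_modulus] at h1
  have h2 : NumberField.HeightOneSpectrum.adicAbv F v (f : F) ≠ 1 :=
    (ord_ne_zero_iff_adicAbv_ne_one F v f.ne_zero).mp hv
  have hpos := (NumberField.HeightOneSpectrum.adicAbv F v).pos f.ne_zero
  exact h2 (Real.eq_one_of_pos_of_log_eq_zero hpos h1)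

end Literature.IUT.LogThetaLattice

end
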